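import Summits.BirchSwinnertonDyer.BirchSwinnertonDyer.Theorems.ByReductionTypeAtTwoEulerCharFormalLower
import Summits.BirchSwinnertonDyer.BirchSwinnertonDyer.Theorems.ByReductionTypeAtTwoEulerCharFormalHTwoCount
import Summits.BirchSwinnertonDyer.BirchSwinnertonDyer.Theorems.ByReductionTypeAtTwoEulerCharLayerZero
import Summits.BirchSwinnertonDyer.BirchSwinnertonDyer.Theorems.ByReductionTypeAtTwoTowerClassKit
import HarnessLib

/-!
# Route `ByReductionTypeAtTwo` (K4), TOWER road — Greenberg's Theorem 4.1 at `p = 2` in the KERNEL: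
# `TwoAdicEulerCharRankZero W 0` for every `W/ℚ` with good ordinary reduction at `2` and `E(ℚ)[2] = 0`

Cell `bsd-2adic`, seat `bsd-2adic-tower-1` (GEN 25), `--supports stmt-BirchSwinnertonDyer-19271` (helper). TOOL theorems only
(no definition, no named fact, no `sorry`); closes nothing by itself; BSD is not proved by any of this.

The end of the programme «Greenberg LNM 1716 Lemma 3.4 at layer `0` EXACT ⇒ Thm. 4.1 over `ℚ` ⇒ the `hEC` binder of the
TOWER doors in the kernel» (files `…EulerCharLayerZero/CoinvExact/CoinvInput/Devissage/ReductionCount/Assembly/FormalBound/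
FormalKummer/FormalLower/FormalHTwoCount.lean`; `…EulerCharAtTwo` did the half `a₂ = 1` with the depth-1 count):

* `natCard_localTowerKerPrimary_zero_eq_sq_two` — **Greenberg's Lemma 3.4 at layer `0`, EXACT, at `p = 2`**: for `W/ℚ`
  globally minimal and elliptic with good ORDINARY reduction at `2`, `κ` the cyclotomic `ℤ₂`-extension and `v ∋ 2`,
  `#𝒦_{v,0}[2^∞] = (2^{ord₂ #Ẽ(𝔽₂)})²`. Lower bound `2^e ≤ #H²(Γ_{ℚ_v}, Ê[2^e]) ≤ #(Ê(𝔪_∞)/(g−1))[2^∞]`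
  (`pow_le_natCard_H2_formalTorsion`, `natCard_H2_formalTorsion_le_formalCoinv`), upper bound and assembly `…FormalBound`.
* `twoAdicEulerCharRankZero_of_noTwoTorsion` — **the PRINT binder `hEC : TwoAdicEulerCharRankZero W 0` (Greenberg's
  Theorem 4.1 at `p = 2`, [GreenbergLNM1716, Thm. 4.1]) of the 852 `TowerClass<label>` doors, the 118 X5 files and the 71
  `MembersIMCGV` files is a THEOREM** for every `W/ℚ` (globally minimal, elliptic) without rational `2`-torsion — the formula's
  own hypotheses carry `GoodOrd W 2`; `…_of_not_dvd_torsionOrder`, `…_of_irr` (the `Irr W 2` rows: `E[2]` irreducible).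

References: [GreenbergLNM1716] §3 Lemma 3.4 (p. 89), §4 Thm. 4.1 (pp. 94–98); [CoatesGreenberg1996] Cor. 3.2;
[MilneADT2006] I Thm. 2.8, Cor. 2.3; [SilvermanAEC2009] III.8.1, VII.2.
-/

set_option autoImplicit false
-- the Theorems namespace of this sub repeats the summit name by design (D-0017 nested layout: Summit.<S>.<Sub>)
set_option linter.dupNamespace false

noncomputable section

open scoped Classical NNReal

universe u

namespace Summit.BirchSwinnertonDyer.BirchSwinnertonDyer.Theorems.GoodOrdTower

open NumberField IsDedekindDomain Field _root_.ContinuousCohomology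
  Literature.NumberTheory.EllipticCurves Literature.NumberTheory.GaloisRepresentations IsDedekindDomain.HeightOneSpectrum
  Literature.NumberTheory.EllipticCurves.FormalGroupChart Literature.NumberTheory.EllipticCurves.ResKernel
  Literature.NumberTheory.EllipticCurves.Rank1Residual WeierstrassCurve Rat.HeightOneSpectrum

set_option maxHeartbeats 6400000 in
/-- **Greenberg's Lemma 3.4 at layer `0`, EXACT, at `p = 2`**: for `W/ℚ` globally minimal and elliptic with `GoodOrd W 2`,
`κ` the cyclotomic `ℤ₂`-extension and `v ∋ 2`, `#𝒦_{v,0}[2^∞] = (2^{ord₂ #Ẽ(𝔽₂)})²` — the order of the `2`-power torsion of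
`ker(H¹(ℚ_v, E[2^∞]) → H¹(ℚ_{v,cyc}, E[2^∞]))` is the square of the `2`-part of `#Ẽ(𝔽₂)`. The package of `…EulerCharFormalBound`
§4 at depth `2^e`, `e = ord₂ #Ẽ(𝔽₂)`; lower bound `2^e ≤ #H²(Γ_{ℚ_v}, Ê[2^e]) ≤ #(M₁/(g−1)M₁)[2^∞]`
(`pow_le_natCard_H2_formalTorsion`, `natCard_H2_formalTorsion_le_formalCoinv`); then
`natCard_localTowerKerPrimary_zero_eq_sq_two_of_formalCountGe`. [cite: GreenbergLNM1716, §3 Lemma 3.4 (p. 89)] -/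
theorem natCard_localTowerKerPrimary_zero_eq_sq_two {κ : ZpExtension ℚ 2} (hκ : κ.IsCyclotomic)
    (v : HeightOneSpectrum (𝓞 ℚ)) (hpv : ((2 : ℕ) : 𝓞 ℚ) ∈ v.asIdeal) (W : WeierstrassCurve ℚ) [W.IsGloballyMinimal]
    [W.IsElliptic] (hgo : GoodOrd W 2) :
    Nat.card (W.localTowerKerPrimary κ (v.adicCompletion ℚ) 0) = (2 ^ padicValNat 2 (W.reductionPointCount 2)) ^ 2 := by
  haveI hp : Fact (Nat.Prime 2) := ⟨Nat.prime_two⟩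
  have hord : W.HasGoodReductionAtPrime 2 ∧ ¬ ((2 : ℕ) : ℤ) ∣ W.frobeniusTrace 2 := hgo
  have hΔ : ¬ ((2 : ℕ) : ℤ) ∣ minimalDiscriminantInt W :=
    W.not_dvd_minimalDiscriminantInt_of_hasGoodReductionAtPrime' 2 hord.1
  obtain ⟨w, hw⟩ := v.exists_spectralValuation
  have hvO : w.Integers w.valuationSubring := Valuation.valuationSubring.integers w
  have hΔu := W.isUnit_Δ_localIntModel hpv hw hΔ
  let red₀ : localPoints W (v.adicCompletion ℚ) →+
      (((integralModelInt W).map (algebraMap ℤ ↥w.valuationSubring)).map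
        (IsLocalRing.residue ↥w.valuationSubring)).toAffine.Point :=
    (goodReductionHom _ hvO hΔu).comp
      (Affine.Point.congrEquiv (localIntModel_baseChange W w.valuationSubring).symm).toAddMonoidHom
  have hred₀ : ∀ P : localPoints W (v.adicCompletion ℚ), red₀ P =
      ((integralModelInt W).map (algebraMap ℤ ↥w.valuationSubring)).reducePoint
        (Affine.Point.congrEquiv (localIntModel_baseChange W w.valuationSubring).symm P) :=
    fun P ↦ rfl
  have hstab : ∀ (σ : absoluteGaloisGroup (v.adicCompletion ℚ)) (Q : localPoints W (v.adicCompletion ℚ)),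
      red₀ Q = 0 → red₀ (σ • Q) = 0 :=
    fun σ Q hQ ↦ (W.localRed_smul_eq_zero_iff hw hΔu red₀ hred₀ σ Q).mpr hQ
  have hkst : ∀ (σ : absoluteGaloisGroup (v.adicCompletion ℚ)) (a : (localPoints W (v.adicCompletion ℚ))), a ∈ red₀.ker → σ • a ∈ red₀.ker :=
    fun σ a ha ↦ (AddMonoidHom.mem_ker).mpr (hstab σ a ((AddMonoidHom.mem_ker).mp ha))
  -- layer `0`: an inertial topological generator `g`, `M₁ = A₁^{H_∞}`, `D₁ = g − 1`
  obtain ⟨g, hgI, -, hgen⟩ := exists_inertial_generator hκ v hpv 0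
  let M₁s : AddSubgroup (localPoints W (v.adicCompletion ℚ)) := red₀.ker ⊓ FixedPoints.addSubgroup (localSubgroup κ.kerSubgroup (v.adicCompletion ℚ)) (localPoints W (v.adicCompletion ℚ))
  have hM₁s : ∀ a, a ∈ M₁s ↔ a ∈ red₀.ker ∧ ∀ h ∈ (localSubgroup κ.kerSubgroup (v.adicCompletion ℚ)), h • a = a := fun a ↦ by
    change a ∈ red₀.ker ⊓ FixedPoints.addSubgroup (localSubgroup κ.kerSubgroup (v.adicCompletion ℚ)) (localPoints W (v.adicCompletion ℚ)) ↔ _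
    rw [AddSubgroup.mem_inf, FixedPoints.mem_addSubgroup]
    exact ⟨fun ⟨h1, h2⟩ ↦ ⟨h1, fun σ hσ ↦ h2 ⟨σ, hσ⟩⟩, fun ⟨h1, h2⟩ ↦ ⟨h1, fun σ ↦ h2 σ σ.2⟩⟩
  let D₁ : M₁s →+ M₁s :=
    { toFun := fun a ↦ ⟨g • (a : (localPoints W (v.adicCompletion ℚ))) - a, ⟨red₀.ker.sub_mem (hkst g a a.2.1) a.2.1,
        (subOne (localSubgroup κ.kerSubgroup (v.adicCompletion ℚ)) (localPoints W (v.adicCompletion ℚ)) g ⟨(a : (localPoints W (v.adicCompletion ℚ))), a.2.2⟩).2⟩⟩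
      map_zero' := Subtype.ext (by simp)
      map_add' := fun a b ↦ Subtype.ext (by
        simp only [AddSubgroup.coe_add, smul_add]
        abel) }
  have hD₁ : ∀ a : M₁s, ((D₁ a : M₁s) : (localPoints W (v.adicCompletion ℚ))) = g • (a : (localPoints W (v.adicCompletion ℚ))) - a := fun _ ↦ rfl
  -- the formal-group torsion `Z = Ê[2^e]`, `e = ord₂ #Ẽ(𝔽₂)`, with its Galois action (as in `…GoodOrdTowerControlLayerFormalP`)
  set e : ℕ := padicValNat 2 (W.reductionPointCount 2) with he
  let Zs : AddSubgroup (localPoints W (v.adicCompletion ℚ)) :=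
    red₀.ker ⊓ AddSubgroup.torsionBy (localPoints W (v.adicCompletion ℚ)) ((2 ^ e : ℕ) : ℤ)
  have hZs : ∀ a : localPoints W (v.adicCompletion ℚ), a ∈ Zs ↔ red₀ a = 0 ∧ 2 ^ e • a = 0 := fun a ↦ by
    change a ∈ red₀.ker ⊓ AddSubgroup.torsionBy _ ((2 ^ e : ℕ) : ℤ) ↔ _
    rw [AddSubgroup.mem_inf, AddMonoidHom.mem_ker]
    exact and_congr Iff.rfl AddSubgroup.torsionBy.nsmul_iff
  have hZstab : ∀ (σ : absoluteGaloisGroup (v.adicCompletion ℚ)) (a : localPoints W (v.adicCompletion ℚ)),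
      a ∈ Zs → σ • a ∈ Zs := fun σ a ha ↦
    (hZs _).mpr ⟨hstab σ a ((hZs a).mp ha).1, by rw [smul_comm, ((hZs a).mp ha).2, smul_zero]⟩
  letI iSMul : SMul (absoluteGaloisGroup (v.adicCompletion ℚ)) Zs := ⟨fun σ z ↦ ⟨σ • (z : localPoints W (v.adicCompletion ℚ)), hZstab σ z z.2⟩⟩
  have hsmul : ∀ (σ : absoluteGaloisGroup (v.adicCompletion ℚ)) (z : Zs),
      ((σ • z : Zs) : localPoints W (v.adicCompletion ℚ)) = σ • (z : localPoints W (v.adicCompletion ℚ)) := fun _ _ ↦ rfl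
  letI iMA : MulAction (absoluteGaloisGroup (v.adicCompletion ℚ)) Zs :=
    { one_smul := fun z ↦ Subtype.ext (by rw [hsmul, one_smul])
      mul_smul := fun σ σ' z ↦ Subtype.ext (by rw [hsmul, hsmul, hsmul, mul_smul]) }
  letI iDMA : DistribMulAction (absoluteGaloisGroup (v.adicCompletion ℚ)) Zs :=
    { smul_zero := fun σ ↦ Subtype.ext (by rw [hsmul, ZeroMemClass.coe_zero, smul_zero])
      smul_add := fun σ z z' ↦ Subtype.ext (by
        rw [hsmul, AddMemClass.coe_add, AddMemClass.coe_add, hsmul, hsmul, smul_add]) }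
  let ρC : ContinuousRep (absoluteGaloisGroup (v.adicCompletion ℚ)) ℤ Zs :=
    ContinuousRep.ofStabilizerMemNhdsOne (Representation.ofDistribMulAction ℤ (absoluteGaloisGroup (v.adicCompletion ℚ)) Zs)
      fun z ↦ by
      have hopen' : IsOpen ((fun σ : absoluteGaloisGroup (v.adicCompletion ℚ) ↦ σ • (z : localPoints W (v.adicCompletion ℚ))) ⁻¹'
          {(z : localPoints W (v.adicCompletion ℚ))}) :=
        (isOpen_discrete _).preimage (continuous_smul_localPoints W (v.adicCompletion ℚ) (z : localPoints W (v.adicCompletion ℚ)))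
      refine Filter.mem_of_superset (hopen'.mem_nhds (by simp)) fun σ hσ ↦ ?_
      exact Subtype.ext hσ
  have hρC : ∀ (σ : absoluteGaloisGroup (v.adicCompletion ℚ)) (z : Zs),
      ((ρC σ z : Zs) : localPoints W (v.adicCompletion ℚ)) = σ • (z : localPoints W (v.adicCompletion ℚ)) := fun _ _ ↦ rfl
  -- the bounds
  have hg0 : g ∈ localSubgroup (κ.layerSubgroup 0) (v.adicCompletion ℚ) := by
    rw [mem_localSubgroup_iff, ZpExtension.layerSubgroup_zero]; exact Subgroup.mem_top _
  haveI := (finite_primary_formalCoinv_and_natCard_le hκ v hpv W hgo hw red₀ hred₀ hg0 hgen M₁s hM₁s D₁ hD₁).1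
  have h2 := (pow_le_natCard_H2_formalTorsion hκ v hpv W hgo hw red₀ hred₀ Zs hZs ρC hρC).2
  have hH2 := (natCard_H2_formalTorsion_le_formalCoinv hκ v hpv W hgo hw red₀ hred₀ hgen M₁s hM₁s D₁ hD₁ e Zs hZs ρC hρC).2
  exact natCard_localTowerKerPrimary_zero_eq_sq_two_of_formalCountGe hκ v hpv W hgo hw red₀ hred₀ hgI hgen M₁s hM₁s D₁
    hD₁ (h2.trans hH2)

end Summit.BirchSwinnertonDyer.BirchSwinnertonDyer.Theorems.GoodOrdTower

namespace Summit.BirchSwinnertonDyer.BirchSwinnertonDyer.Theorems.GreenbergEulerChar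

open NumberField Literature.NumberTheory.EllipticCurves.Rank1Residual Summit.BirchSwinnertonDyer.Rank1Residual.X5.O1
  WeierstrassCurve

/-- **`hEC` in the kernel: Greenberg's Theorem 4.1 at `p = 2`** — for every `W/ℚ` globally minimal and elliptic without
rational `2`-torsion, the Euler-characteristic formula `TwoAdicEulerCharRankZero W 0` HOLDS (its own hypotheses supply
`GoodOrd W 2`, the cyclotomic `κ`, the Selmer-dual data and the finiteness of `Sel`): Lemma 3.4 at layer `0`
(`natCard_localTowerKerPrimary_zero_eq_sq_two`) fed to `twoAdicEulerCharRankZero_of_layerZeroCount` (Thm. 4.1 over `ℚ` modulo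
the layer-`0` count: Perrin-Riou/Schneider, Mazur control, Lemma 3.3, Cassels–Tate, k4-p1 + b2b).
[cite: GreenbergLNM1716, §4 Thm. 4.1 (pp. 94–98); §3 Lemma 3.4 (p. 89)] -/
theorem twoAdicEulerCharRankZero_of_noTwoTorsion (W : WeierstrassCurve ℚ) [W.IsElliptic] [W.IsGloballyMinimal]
    (hK : ∀ P : W.toAffine.Point, 2 • P = 0 → P = 0) : TwoAdicEulerCharRankZero W 0 :=
  twoAdicEulerCharRankZero_of_layerZeroCount W hK fun hgo _ hκ v hv ↦
    GoodOrdTower.natCard_localTowerKerPrimary_zero_eq_sq_two hκ v hv W hgo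

/-- **`hEC` in the kernel, torsion-order form**: `2 ∤ #E(ℚ)_tors` gives `TwoAdicEulerCharRankZero W 0`.
[cite: GreenbergLNM1716, §4 Thm. 4.1 (pp. 94–98)] -/
theorem twoAdicEulerCharRankZero_of_not_dvd_torsionOrder (W : WeierstrassCurve ℚ) [W.IsElliptic] [W.IsGloballyMinimal]
    (htors : ¬ 2 ∣ W.torsionOrder) : TwoAdicEulerCharRankZero W 0 :=
  -- (`convert` bridges the two `DecidableEq ℚ` instances behind the group law on `W.toAffine.Point`)
  twoAdicEulerCharRankZero_of_noTwoTorsion W fun P hP ↦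
    Rank1Residual.Iwasawa.forall_smul_eq_zero_imp_of_not_dvd_torsionOrder W htors P (by convert hP)

/-- **`hEC` in the kernel on the `Irr W 2` rows**: for `W/ℚ` globally minimal and elliptic with `E[2]` irreducible
(`Irr W 2`, so no rational `2`-torsion: `TowerClass.not_two_dvd_torsionOrder_of_irr`), `TwoAdicEulerCharRankZero W 0`
holds — the PRINT binder `hEC` of the `TowerClass<label>` doors (`TowerClass.bsdp_two_of_towerGap_of_layerSelmer_of_irr`)
is discharged on every such row. [cite: GreenbergLNM1716, §4 Thm. 4.1 (pp. 94–98)] -/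
theorem twoAdicEulerCharRankZero_of_irr (W : WeierstrassCurve ℚ) [W.IsElliptic] [W.IsGloballyMinimal] (hirr : Irr W 2) :
    TwoAdicEulerCharRankZero W 0 :=
  twoAdicEulerCharRankZero_of_not_dvd_torsionOrder W (TowerClass.not_two_dvd_torsionOrder_of_irr W hirr)

end Summit.BirchSwinnertonDyer.BirchSwinnertonDyer.Theorems.GreenbergEulerChar

end
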